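import Literature.AlgebraicGeometry.AbelianSchemes.HeckeQuotientTriple
import Literature.AlgebraicGeometry.AbelianSchemes.LevelSectionsSubgroup
import Literature.AlgebraicGeometry.AbelianSchemes.LevelStructureOfHeckeQuotientResidue
import Literature.AlgebraicGeometry.AbelianSchemes.AbelianSchemeConstSubgroupQuotientEtale
import Literature.AlgebraicGeometry.AbelianSchemes.AbelianSchemeQuotientPolarizationPullbackOfReduced
import Literature.AlgebraicGeometry.ModuliOfAbelianVarieties.SiegelHeckeDatumIntegral
import HarnessLib

/-!
# The Hecke quotient triple of a typed level-`N·d` family at a principal link datum — the socket-(B) GLUE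

The GLUE between the arithmetic of a Hecke link datum and the (ii)-chain quotient construction.  Data: a reduced,
separated, locally Noetherian base `S` over an affine Noetherian `Y`, a typed triple `P′ = (A′, λ′, σ′)` over `S` of
level `N·d` and type `δ`, principal representatives `r, r′ ∈ K_δ(1)` and a rational `γ` adapted to them
(★ `QuotientAdapted δ δ N (N·d) r r′ γ`) with similitude factor `d` and integral matrix `γm`.  The KERNEL INDEX SET is
`K₀ := ker (γ̄m · (r′ mod N·d)) ≤ (ℤ/N·d)^{2g}` and the constant subgroup is `K := σ′(K₀) ≤ A′(S)` (★
`LevelStructure.exists_subgroup_mem_iff`); it is `d`-torsion (★ `QuotientAdapted.exists_intDatum` + ★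
`smul_eq_zero_of_kernelIndex` + ★ `LevelStructure.pow_eq_one_of_mem_iff`) and acts freely (★
`LevelStructure.translation_ne_of_mem_iff`).  Given, for THIS `K`, the external package `hExt` of the (ii)-chain — the
stable affine covers `hcov/hcov′`, the group laws / smoothness / connectedness of the two quotients, the dual side
`(K′, hfree′, Φ)`, the universal property `h4` (D6), the descent clause `hlam` («`λ′(K) ⊆ K′`»), and a polarisation
structure `polB` on `(A′/K, D_B)` with `polB.lam = polarizationDesc λ′` of type `δ` ((X-amp) + H2c) — the file produces
the typed level-`N` triple `Q` and `ψ := quotientMk : A′ → Q.A` with the three socket clauses (level `σ_B = σ′^d ≫ ψ`,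
kernel indexed by `K₀`, Λ-clause `Λ(ψ_t^*Θ₀) = λ′^d`): the level/symplectic field is ★
`LevelStructure.exists_level_symplectic_of_heckeQuotient_residue`, the relative dimension ★ `isOfRelDim_quotientBy`, the
assembly ★ `exists_quotientTriple_of_fields`.  This is exactly the body of the hypothesis `hQ` of ★
`EquidimHeckeQuotientFamily.socketQuotientMaps_of_quotientTriples'` at `N′ = N·d`, `δ′ = δ`.

References: [Milne2005ShimuraVarieties, §6 Thm. 6.11 pp. 74–75]; [MumfordAV1970, §23 Thm. 2 p. 231, §7 Thm. 4 p. 72];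
[MumfordFogartyKirwan1994, Ch. 7 §3 p. 139]; [Deligne1971TravauxShimura, 4.11–4.12 pp. 148–149].
-/

noncomputable section

universe u

open CategoryTheory CategoryTheory.Limits AlgebraicGeometry MonoidalCategory Matrix NumberField IsDedekindDomain
open scoped MonObj
open Literature.AlgebraicGeometry.AbelianSchemes Literature.AlgebraicGeometry.AbelianSchemes.AbelianSchemeOver
open Literature.AlgebraicGeometry.Motives Literature.NumberTheory.Adeles

namespace Literature.AlgebraicGeometry.ModuliOfAbelianVarieties

/-- **THE HECKE QUOTIENT TRIPLE AT A PRINCIPAL LINK DATUM, FROM THE EXTERNAL (ii)-CHAIN PACKAGE.**  See the module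
docstring: for the constant subgroup `K = σ′(ker (γ̄m · (r′ mod N·d)))` of the typed level-`N·d` family `P′` (built here,
`d`-torsion and free, and HANDED to the package with its enumeration clause), the external package `hExt` (covers, quotient group laws/smoothness/connectedness, dual side
`K′, hfree′, Φ`, universality `h4`, descent clause `hlam`, and a polarisation structure `polB` of type `δ` on the quotient
with `polB.lam = polarizationDesc λ′`) yields the typed level-`N` quotient triple `Q` and the epimorphism
`ψ = quotientMk : A′ → Q.A` with the level, kernel and Λ-clauses of the socket-(B) hypothesis `hQ`.
[cite: Milne2005ShimuraVarieties, §6 Thm. 6.11 pp. 74–75] [cite: MumfordAV1970, §23 Thm. 2 (p. 231) and §7 Thm. 4 (p. 72)]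
[cite: MumfordFogartyKirwan1994, Ch. 7 §3 (p. 139)] -/
theorem exists_heckeQuotientTriple_of_ext {g N d : ℕ} {δ : Fin g → ℕ} (hg : 0 < g) (hδ : IsPolarizationType δ)
    (hN : N ≠ 0) (hd0 : d ≠ 0) [NeZero (N * d)]
    {S Y : Scheme.{u}} [IsReduced S] [IsLocallyNoetherian S] [S.IsSeparated] (u : S ⟶ Y)
    [IsAffine Y] [IsLocallyNoetherian Y] [Y.IsSeparated]
    (P' : PolarizedAbelianSchemeWithLevel g (N * d) δ S)
    [IsSeparated (P'.A.X.hom ≫ u)] [LocallyOfFiniteType (P'.A.X.hom ≫ u)]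
    [IsSeparated (P'.D.hat.X.hom ≫ u)] [LocallyOfFiniteType (P'.D.hat.X.hom ≫ u)]
    {r r' : gspFinAdelic δ} (hr : r ∈ principalLevelSubgroup δ 1) (hr' : r' ∈ principalLevelSubgroup δ 1)
    {γq : GL (Fin g ⊕ Fin g) ℚ} (hQA : QuotientAdapted δ δ N (N * d) r r' γq)
    (hsim : (γq : Matrix (Fin g ⊕ Fin g) (Fin g ⊕ Fin g) ℚ)ᵀ * typeFormOver δ ℚ *
      (γq : Matrix (Fin g ⊕ Fin g) (Fin g ⊕ Fin g) ℚ) = (d : ℚ) • typeFormOver δ ℚ)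
    (γm : Matrix (Fin g ⊕ Fin g) (Fin g ⊕ Fin g) ℤ)
    (hγ : ((γq : GL (Fin g ⊕ Fin g) ℚ) : Matrix (Fin g ⊕ Fin g) (Fin g ⊕ Fin g) ℚ) = γm.map (Int.cast : ℤ → ℚ))
    (hExt : ∀ (K : Subgroup P'.A.Sections) [Finite K] (hK : ∀ σ : K, (σ : P'.A.Sections) ^ d = 1)
      (hfree : ∀ (Ω : Type u) [Field Ω] [IsAlgClosed Ω] (x : Spec (.of Ω) ⟶ P'.A.left) (σ : K), σ ≠ 1 →
        x ≫ (P'.A.translation (σ : P'.A.Sections)).left ≠ x)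
      (_ : ∀ σ : P'.A.Sections, σ ∈ K ↔ ∃ c ∈ {c : Fin g ⊕ Fin g → ZMod (N * d) |
          (γm.map (Int.castRingHom (ZMod (N * d))) *
            Matrix.of (fun i j => integralAdeleResidue (N * d)
              ⟨((r' : GL (Fin g ⊕ Fin g) finAdeleQ) : Matrix (Fin g ⊕ Fin g) (Fin g ⊕ Fin g) finAdeleQ) i j,
                entries_mem_integralAdeles_of_mem_principalLevelSubgroup_one hr' i j⟩)) *ᵥ c = 0},
          P'.level.section_ c = σ),
      haveI : IsCommMonObj P'.A.X := P'.A.isCommMonObj_of_isReduced_base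
      ∃ (hcov : ∀ x : P'.A.left, ∃ O : (P'.A.translationActionOver u K).StableAffineOpens, x ∈ O.1)
        (hG : ∃ _ : GrpObj (P'.A.quotientOver u K), IsMonHom (P'.A.quotientMk u K hcov))
        (hsm : Smooth (P'.A.quotientOver u K).hom) (hgc : GeometricallyConnected (P'.A.quotientOver u K).hom)
        (K' : Subgroup P'.D.hat.Sections) (_ : Finite K')
        (hcov' : ∀ x : P'.D.hat.left, ∃ O : (P'.D.hat.translationActionOver u K').StableAffineOpens, x ∈ O.1)
        (hG' : ∃ _ : GrpObj (P'.D.hat.quotientOver u K'), IsMonHom (P'.D.hat.quotientMk u K' hcov'))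
        (hsm' : Smooth (P'.D.hat.quotientOver u K').hom)
        (hgc' : GeometricallyConnected (P'.D.hat.quotientOver u K').hom)
        (hfree' : ∀ (Ω : Type u) [Field Ω] [IsAlgClosed Ω] (x : Spec (.of Ω) ⟶ P'.D.hat.left) (σ : K'), σ ≠ 1 →
          x ≫ (P'.D.hat.translation (σ : P'.D.hat.Sections)).left ≠ x)
        (Φ : (prodTranslationActionOver (P'.A.quotientBy u K hcov hG hsm hgc) P'.D.hat u K' hcov').EquivariantStructure
          (P'.A.poincarePullback u K hK hcov hG hsm hgc P'.D hfree))
        (h4 : ∀ {T : Scheme.{u}} (f : T ⟶ S) (ℒ : (P'.A.quotientBy u K hcov hG hsm hgc).RigidifiedLineBundle f),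
          ℒ.FibrewisePicZero →
          ∃! g : {g : T ⟶ (P'.D.hat.quotientBy u K' hcov' hG' hsm' hgc').X.left //
              g ≫ (P'.D.hat.quotientBy u K' hcov' hG' hsm' hgc').X.hom = f},
            Nonempty ((Scheme.Modules.pullback ((P'.A.quotientBy u K hcov hG hsm hgc).baseChangeToProd
              (P'.D.hat.quotientBy u K' hcov' hG' hsm' hgc') f g.1 g.2)).obj
                (P'.A.poincareQuotRigid u K hK hcov hG hsm hgc P'.D hfree K' hcov' hG' hsm' hgc' Φ) ≅ ℒ.L))
        (hlam : ∀ σ : K, P'.A.translation (σ : P'.A.Sections) ≫ P'.pol.lam ≫ P'.D.hat.quotientMk u K' hcov' =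
          P'.pol.lam ≫ P'.D.hat.quotientMk u K' hcov')
        (polB : (P'.A.quotientBy u K hcov hG hsm hgc).Polarization
          (P'.A.dualPairOfQuotientRigidified u K hK hcov hG hsm hgc P'.D hfree K' hcov' hG' hsm' hgc' hfree' Φ h4))
        (_ : polB.lam = P'.A.polarizationDesc u K hcov P'.D.hat K' hcov' P'.pol.lam hlam),
        polB.HasType δ) :
    ∃ (Q : PolarizedAbelianSchemeWithLevel g N δ S) (ψ : P'.A.X ⟶ Q.A.X) (_ : IsMonHom ψ) (_ : Surjective ψ.left)
      (_ : LocallyOfFiniteType ψ.left),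
      (∀ i, Q.level.σ i = (P'.level.σ i ^ d) ≫ ψ) ∧
      (∀ (Ω : Type u) [Field Ω] [IsAlgClosed Ω] (s : Spec (.of Ω) ⟶ S) (x : P'.A.FibrePoints s),
        x ≫ ψ = 1 ↔ ∃ c ∈ {c : Fin g ⊕ Fin g → ZMod (N * d) |
            (γm.map (Int.castRingHom (ZMod (N * d))) *
              Matrix.of (fun i j => integralAdeleResidue (N * d)
                ⟨((r' : GL (Fin g ⊕ Fin g) finAdeleQ) : Matrix (Fin g ⊕ Fin g) (Fin g ⊕ Fin g) finAdeleQ) i j,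
                  entries_mem_integralAdeles_of_mem_principalLevelSubgroup_one hr' i j⟩)) *ᵥ c = 0},
          x = P'.A.restrict s (P'.level.section_ c)) ∧
      (∀ (Ω : Type u) [Field Ω] [IsAlgClosed Ω] (t : Spec (.of Ω) ⟶ S)
        (Θ₀ : CartierDivisor (Q.A.fibre t).toAbelianVariety.X.left),
        haveI := isDominant_toSchemeHom_fibreHom ψ t
        Q.A.IsLambdaOfAt t Q.D Q.pol.lam Θ₀ →
          P'.A.IsLambdaOfAt t P'.D (P'.pol.lam ^ d)
            (Θ₀.pullback (AbelianVariety.Hom.toSchemeHom (fibreHom ψ t)))) := by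
  classical
  haveI hcommA : IsCommMonObj P'.A.X := P'.A.isCommMonObj_of_isReduced_base
  -- ### the arithmetic of the datum: `γs`, `γm γs = γs γm = d`, the integral similitude, `γ ≡ 1 (N)`
  obtain ⟨γs, hγ1, hγ2, hsimZ, hQA4⟩ := hQA.exists_intDatum hr hN rfl hd0 hsim γm hγ
  -- ### `R′ = r′ mod N·d`, an element of `GL_{2g}(ℤ/N·d)` (the residue homomorphism on `K_δ(1)`)
  set R' : Matrix (Fin g ⊕ Fin g) (Fin g ⊕ Fin g) (ZMod (N * d)) := Matrix.of (fun i j => integralAdeleResidue (N * d)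
    ⟨((r' : GL (Fin g ⊕ Fin g) finAdeleQ) : Matrix (Fin g ⊕ Fin g) (Fin g ⊕ Fin g) finAdeleQ) i j,
      entries_mem_integralAdeles_of_mem_principalLevelSubgroup_one hr' i j⟩) with hR'def
  obtain ⟨ρ, hρ, -⟩ := exists_monoidHom_principalLevelSubgroup_one_integralAdeleResidue (N * d) δ
  have hRρ : ((ρ ⟨r', hr'⟩ : GL (Fin g ⊕ Fin g) (ZMod (N * d))) :
      Matrix (Fin g ⊕ Fin g) (Fin g ⊕ Fin g) (ZMod (N * d))) = R' := by
    ext i j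
    rw [hρ ⟨r', hr'⟩ i j (entries_mem_integralAdeles_of_mem_principalLevelSubgroup_one hr' i j), hR'def, Matrix.of_apply]
  -- ### the kernel index set `K₀ = ker (γ̄m · R′)` as an additive subgroup, and `K := σ′(K₀)`
  set M : Matrix (Fin g ⊕ Fin g) (Fin g ⊕ Fin g) (ZMod (N * d)) := γm.map (Int.castRingHom (ZMod (N * d))) * R'
    with hMdef
  let K₀ : AddSubgroup (Fin g ⊕ Fin g → ZMod (N * d)) :=
    { carrier := {c | M *ᵥ c = 0}
      zero_mem' := by simp
      add_mem' := fun {a b} ha hb => by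
        simp only [Set.mem_setOf_eq] at ha hb ⊢
        rw [Matrix.mulVec_add, ha, hb, add_zero]
      neg_mem' := fun {a} ha => by
        simp only [Set.mem_setOf_eq] at ha ⊢
        rw [Matrix.mulVec_neg, ha, neg_zero] }
  have hK₀ : ∀ c, c ∈ K₀ ↔ M *ᵥ c = 0 := fun c => Iff.rfl
  obtain ⟨K, hKr⟩ := P'.level.exists_subgroup_mem_iff K₀
  have hKr' : ∀ σ : P'.A.Sections, σ ∈ K ↔ ∃ c ∈ {c : Fin g ⊕ Fin g → ZMod (N * d) | M *ᵥ c = 0},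
      P'.level.section_ c = σ := fun σ => hKr σ
  haveI hKfin : Finite K := P'.level.finite_of_mem_iff hKr'
  -- `K` is `d`-torsion and free
  have hm : ∀ c ∈ {c : Fin g ⊕ Fin g → ZMod (N * d) | M *ᵥ c = 0}, (d : ZMod (N * d)) • c = 0 := fun c hc =>
    smul_eq_zero_of_kernelIndex γm γs hγ2 (ρ ⟨r', hr'⟩) c (by rw [hRρ]; exact hc)
  have hK : ∀ σ : K, (σ : P'.A.Sections) ^ d = 1 := P'.level.pow_eq_one_of_mem_iff hKr' hm
  have hfree := P'.level.translation_ne_of_mem_iff hKr'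
  -- ### the external package for this `K`
  obtain ⟨hcov, hG, hsm, hgc, K', hK'fin, hcov', hG', hsm', hgc', hfree', Φ, h4, hlam, polB, hpolB, htype⟩ :=
    hExt K hK hfree hKr'
  -- ### quotient-side facts
  letI : GrpObj (P'.A.quotientOver u K) := (P'.A.quotientBy u K hcov hG hsm hgc).grpObj
  haveI hψ := P'.A.isMonHom_quotientMk u K hcov hG hsm hgc
  haveI hψ' : @IsMonHom _ _ _ P'.A.X (P'.A.quotientBy u K hcov hG hsm hgc).X _ _ (P'.A.quotientMk u K hcov) := hψ
  haveI : IsCommMonObj (P'.A.quotientBy u K hcov hG hsm hgc).X :=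
    (P'.A.quotientBy u K hcov hG hsm hgc).isCommMonObj_of_isReduced_base
  have hrel : (P'.A.quotientBy u K hcov hG hsm hgc).IsOfRelDim g :=
    P'.A.isOfRelDim_quotientBy u K hcov hG hsm hgc hfree P'.relDim
  haveI := P'.pol.isMonHom
  -- export (b), `.left` form: `ψ ≫ λ_B ≫ ψ^∨ = λ′ ≫ [d]`
  have hb := P'.A.quotientMk_comp_polarizationDesc_comp_dualIsogeny_of_isReduced u K hK hcov hG hsm hgc P'.D hfree K'
    hcov' hG' hsm' hgc' hfree' Φ h4 P'.pol.nonempty_unitHatSlice_iso P'.pol.lam hlam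
  rw [← hpolB] at hb
  -- ### the level-`N` structure of the quotient, symplectic-liftable for `polB` (★ B-p04)
  have hlev : ∃ ψφ : (P'.A.quotientBy u K hcov hG hsm hgc).LevelStructure g N,
      (∀ i, ψφ.σ i = (P'.level.σ i ^ d) ≫
        (show P'.A.X ⟶ (P'.A.quotientBy u K hcov hG hsm hgc).X from P'.A.quotientMk u K hcov)) ∧
      ψφ.IsSymplecticLiftable polB δ :=
    LevelStructure.exists_level_symplectic_of_heckeQuotient_residue hg hδ hN hd0
      (show P'.A.X ⟶ (P'.A.quotientBy u K hcov hG hsm hgc).X from P'.A.quotientMk u K hcov) hrel γm γs hγ1 hγ2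
      hsimZ hQA4 r' hr' R' (fun i j h => by rw [hR'def, Matrix.of_apply])
      (fun Ω _ _ s y => P'.A.quotientBy_ontoFibres u K hcov hG hsm hgc s y)
      (fun Ω _ _ s x => P'.A.comp_quotientMk_eq_one_iff_of_range u K hcov hG hsm hgc hfree
        {c : Fin g ⊕ Fin g → ZMod (N * d) | M *ᵥ c = 0} P'.level.section_ hKr' s x)
      hb P'.symplectic
  -- ### assembly
  exact P'.A.exists_quotientTriple_of_fields u K hK hcov hG hsm hgc P'.D hfree K' hcov' hG' hsm' hgc' hfree' Φ h4 P'.pol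
    hlam polB hpolB htype hrel P'.level hlev {c : Fin g ⊕ Fin g → ZMod (N * d) | M *ᵥ c = 0} hKr'

end Literature.AlgebraicGeometry.ModuliOfAbelianVarieties

end
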